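import Literature.NumberTheory.GelbartRogawski1991.LocalSplittingCMScaleTransport
import Literature.NumberTheory.GelbartRogawski1991.LocalLineIsometryRigidity
import Literature.NumberTheory.GelbartRogawski1991.LocalKudlaSplittingRigiditySplit
import Literature.NumberTheory.GelbartRogawski1991.LocalUnitarySplittingsCMExplicit
import Literature.NumberTheory.GelbartRogawski1991.UndoublingPlaceAssembly
import Literature.NumberTheory.GelbartRogawski1991.LocalDoubledUnitaryDeltaTransport
import Literature.NumberTheory.Automorphic.Liu2021.Def411WeilCarriersDoubling
import HarnessLib

/-!
# Naturality of the CM local splitting under the local isometry of two skew-hermitian lines (S6a)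

Topic `NumberTheory/GelbartRogawski1991`; namespace `Literature.NumberTheory.GelbartRogawski1991.UnitaryDualPair.LocalSplitting`.  KERNEL ONLY:
theorems; no definition, no named fact, no `sorry`.  Cell hodgecm-mathlib, line a4-liuD3 of [Liu2021, App. D Lem. D.1 (3)]
(registered residual `stub_lineRigidityS6a_nonsplit` and the split twin; stub `stub_iso_of_params`): for a CM field `L`, a real
frame `dV`, a splitting character `χ`, two lines `a₁, a₂ ∈ L⁺ˣ`, a finite place `v` of `L⁺` and a unit `x` of `L ⊗ L⁺_v`
with `a₂⁻¹δ = x xᶜ a₁⁻¹δ` (`δ = imagUnit L`), the line transport by `x` ([MoeglinVignerasWaldspurger1987, Chap. 3 I.1–I.3],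
`lineTransportSplitting`) of the `χ`-attached local splitting on the line `a₁`, read in the `(T_V, δ/a₁)`-model
(`lineTransportSection`, `LocalLineModelTransport`), IS the `χ`-attached local splitting on the line `a₂` read in the
`(T_V, δ/a₂)`-model — `lineTransportSplitting_lineTransportSection_congrW_undoubledSplittings`.

Proof = the doubled-level rigidity chain of this package, all KERNEL: (1) both undoubled sections, transported, are the
undoublings of the SCALE-TRANSPORTED doubled CM sections `Σ_{a}` of `H = U(T_V ⊕ −T_V)` over `ι^𝔻_{δ/a}`
(`scaleTransportSection_localSplittingCMWith`, `lineTransportSection_eq_scaleTransportSection`, the `congrW` transport of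
`UndoublingPlaceAssembly`); (2) `Σ_{a₁}`, `Σ_{a₂}` are `P_Δ`-normalised with the same scalar
(`parabolic_toRep_conj_scaleTransport_localSplittingDatumCM`), every character of `H(L⁺_v)` trivial on `P_Δ` is trivial at EVERY
finite place (`eq_one_of_forall_isSiegelDelta_eq_one'`, B-p13/B-p18), a mover of `ℓ_Δ` onto `ℓ_Y` exists (`deltaD`,
`map_transportSp_deltaDiag_deltaLagrangian`), so the conjugate of `Σ_{a₁}` by a lift `P` of the doubled line isometry `γ_x` IS
`Σ_{a₂}` (`conj_comp_eq_of_parabolic`) — GIVEN that `γ_x` preserves `ℓ_Δ` (hypothesis `hΔ`); (3) undoubling commutes with the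
conjugation by `P` (hypothesis `hD4`).  The two hypotheses `hΔ`, `hD4` are the statements of the companion file
`LocalLineIsometryUndoubling` (B-p02, F8a of the cell plan); with them discharged by name the theorem is hypothesis-free at
every finite place.

References: [GelbartRogawski1991] §3.1 Prop. 3.1.1 p. 455, Remark p. 457; [Kudla1994] §3 Thm. 3.1; [HarrisKudlaSweet1996] §1
(1.11)–(1.16); [MoeglinVignerasWaldspurger1987] Chap. 2 II.1, Chap. 3 I.1–I.3; [Liu2021] App. D §D.1, Lem. D.1 (3) (l. 5233).
-/

set_option autoImplicit false

noncomputable section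

open scoped Matrix Kronecker
open NumberField IsDedekindDomain
open Literature.RepresentationTheory.HeisenbergGroup Literature.RepresentationTheory.HeisenbergGroup.SymplecticMatrix
open Literature.RepresentationTheory.MoeglinVignerasWaldspurger1987
open Literature.NumberTheory.Automorphic Literature.NumberTheory.Automorphic.UnitaryGroup
open Literature.NumberTheory.Weil1964
open Literature.RepresentationTheory.HarrisKudlaSweet1996
open Literature.NumberTheory.GaloisRepresentations
open Literature.LinearAlgebra.QuadraticForm
open Literature.NumberTheory.Automorphic.Liu2021.Def411WeilCarriers (TW JW JW_eq isSymm_TW isUnit_det_TW)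
open Literature.NumberTheory.Automorphic.Liu2021.Def411WeilCarriersDoubling (lineW complexConj_lineW lineW_ne_zero
  realDiagonal_lineW diagonal_lineW)

/-! ## §0 Plumbing: `undoubleLoc` along equal sections -/

namespace Literature.NumberTheory.GelbartRogawski1991.UnitaryDualPair.LocalSplitting

/-- `undoubleLoc s = undoubleLoc s'` for equal sections `s = s'` (the proof arguments are irrelevant).
[cite: GelbartRogawski1991, §3.1 Prop. 3.1.1 p. 455 L1–3] -/
theorem undoubleLoc_congr_s (F : Type) [Field F] [NumberField F] (E : Type) [Field E] [NumberField E] [Algebra F E]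
    (c : E ≃ₐ[F] E) (v : HeightOneSpectrum (𝓞 F)) (n : ℕ) {T₀ : Matrix (Fin n) (Fin n) F}
    {J : Matrix (Fin n) (Fin n) E} (hJ : J = T₀.map (algebraMap F E))
    {JD : Matrix (Fin (n + n)) (Fin (n + n)) E} (hJD : JD = (gramD F n T₀).map (algebraMap F E))
    [Algebra.IsQuadraticExtension F E] {δ : E} (hcδ : c δ = -δ) (hδ : δ ≠ 0) {d : F} (hd : δ * δ = algebraMap F E d)
    (hT₀ : T₀.IsSymm) (hT₀d : IsUnit T₀.det)
    {s s' : UnitaryGroup.localPi E c (n + n) JD v →* LocalMp F (n + n) (gramD F n T₀) v} (h : s = s')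
    (hs : ∀ g, MpPsi.proj _ (s g) = iota F E c (n + n) hcδ hδ hd (gramD F n T₀) (gramD_isSymm F n hT₀) hJD v g)
    (hs' : ∀ g, MpPsi.proj _ (s' g) = iota F E c (n + n) hcδ hδ hd (gramD F n T₀) (gramD_isSymm F n hT₀) hJD v g) :
    undoubleLoc F E c v n hJ hJD hcδ hδ hd hT₀ hT₀d s hs = undoubleLoc F E c v n hJ hJD hcδ hδ hd hT₀ hT₀d s' hs' := by
  subst h
  rfl

/-- `scaleTransportSection s′ = scaleTransportSection s″` for equal sections `s′ = s″` (the proof arguments are irrelevant).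
[cite: MoeglinVignerasWaldspurger1987, Chap. 2 II.1] -/
theorem scaleTransportSection_congr_s (F E : Type) [Field F] [NumberField F] [Field E] [NumberField E] [Algebra F E]
    [Algebra.IsQuadraticExtension F E] (c : E ≃ₐ[F] E) (N : ℕ) {δ : E} (hcδ : c δ = -δ) (hδ : δ ≠ 0) {d : F}
    (hd : δ * δ = algebraMap F E d) (T T' : Matrix (Fin N) (Fin N) F) (hT : T.IsSymm) (hT' : T'.IsSymm) (a : Fˣ)
    (hTT' : T' = (a : F) • T) {J J' : Matrix (Fin N) (Fin N) E} (hJ : J = T.map (algebraMap F E))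
    (hJ' : J' = T'.map (algebraMap F E)) (v : HeightOneSpectrum (𝓞 F))
    {s' s'' : UnitaryGroup.localPi E c N J' v →* LocalMp F N T' v} (h : s' = s'')
    (hs' : ∀ g, MpPsi.proj _ (s' g) = iota F E c N hcδ hδ hd T' hT' hJ' v g)
    (hs'' : ∀ g, MpPsi.proj _ (s'' g) = iota F E c N hcδ hδ hd T' hT' hJ' v g) :
    scaleTransportSection F E c N hcδ hδ hd T T' hT hT' a hTT' hJ hJ' v s' hs' =
      scaleTransportSection F E c N hcδ hδ hd T T' hT hT' a hTT' hJ hJ' v s'' hs'' := by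
  subst h
  rfl

end Literature.NumberTheory.GelbartRogawski1991.UnitaryDualPair.LocalSplitting

namespace Literature.NumberTheory.GelbartRogawski1991.UnitaryDualPair.LocalSplitting

open MeasureTheory
open Literature.NumberTheory.GelbartRogawski1991.GRConstruction (Fp gramR gramR_isSymm isUnit_det_gramR₀ congrW undoubledSplittings
  cmFinLocalFamily deltaD undouble_finSplittings_cmFinLocalFamily_s borelPlaceMeasure)

variable (L : Type) [Field L] [NumberField L] [IsCMField L] {N : ℕ}
  (dV : Fin N → L) (hdV : ∀ i, IsCMField.complexConj L (dV i) = dV i) (hdV0 : ∀ i, dV i ≠ 0)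
  (v : HeightOneSpectrum (𝓞 (Fp L)))

/-! ## §1 The `congrW` transport is invisible to the scale transport -/

/-- the scale transport of a family member read on the consumers' W-side Gram data (`congrW hT hJ 𝓢`, `UndoublingPlaceAssembly`)
is the scale transport of the member itself (`subst`-class bookkeeping). [cite: GelbartRogawski1991, §3.1 Prop. 3.1.1 p. 455 L1–3] -/
theorem scaleTransportSection_congrW_s (dW : Fin 1 → L) (hdW : ∀ i, IsCMField.complexConj L (dW i) = dW i)
    {TW' : Matrix (Fin 1) (Fin 1) (Fp L)} {JW' : Matrix (Fin 1) (Fin 1) L} (hT : realDiagonal L dW hdW = TW')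
    (hJ : Matrix.diagonal dW = JW') (hW' : TW'.IsSymm) (hJW' : JW' = TW'.map (algebraMap (Fp L) L))
    (𝓢 : FinLocalSplittings (Fp L) L (IsCMField.complexConj L) N (complexConj_imagUnit L) (imagUnit_ne_zero L)
      (imagUnit_mul_self L) (gramR L (Equiv.prodUnique (Fin N) (Fin 1)) dV hdV dW hdW)
      (gramR_isSymm L (Equiv.prodUnique (Fin N) (Fin 1)) dV hdV dW hdW)
      (J := Matrix.reindex (Equiv.prodUnique (Fin N) (Fin 1)) (Equiv.prodUnique (Fin N) (Fin 1))
        (Matrix.diagonal dV ⊗ₖ Matrix.diagonal dW))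
      (reindex_kronecker_eq_gram_map (Fp L) L (Equiv.prodUnique (Fin N) (Fin 1)) (realDiagonal_map L dV hdV).symm
        (realDiagonal_map L dW hdW).symm))
    (a : (Fp L)ˣ) (h₁ : gram (Fp L) (Equiv.prodUnique (Fin N) (Fin 1)) (realDiagonal L dV hdV) TW' = (a : Fp L) • realDiagonal L dV hdV)
    (h₂ : gramR L (Equiv.prodUnique (Fin N) (Fin 1)) dV hdV dW hdW = (a : Fp L) • realDiagonal L dV hdV) :
    scaleTransportSection (Fp L) L (IsCMField.complexConj L) N (complexConj_imagUnit L) (imagUnit_ne_zero L) (imagUnit_mul_self L)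
        (realDiagonal L dV hdV) (gram (Fp L) (Equiv.prodUnique (Fin N) (Fin 1)) (realDiagonal L dV hdV) TW')
        (realDiagonal_isSymm L dV hdV) (isSymm_gram (Fp L) (Equiv.prodUnique (Fin N) (Fin 1)) (realDiagonal_isSymm L dV hdV) hW')
        a h₁ (realDiagonal_map L dV hdV).symm
        (reindex_kronecker_eq_gram_map (Fp L) L (Equiv.prodUnique (Fin N) (Fin 1)) (realDiagonal_map L dV hdV).symm hJW') v
        ((congrW L (Equiv.prodUnique (Fin N) (Fin 1)) dV hdV dW hdW hT hJ 𝓢 hW' hJW').s v)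
        ((congrW L (Equiv.prodUnique (Fin N) (Fin 1)) dV hdV dW hdW hT hJ 𝓢 hW' hJW').proj_s v) =
      scaleTransportSection (Fp L) L (IsCMField.complexConj L) N (complexConj_imagUnit L) (imagUnit_ne_zero L) (imagUnit_mul_self L)
        (realDiagonal L dV hdV) (gramR L (Equiv.prodUnique (Fin N) (Fin 1)) dV hdV dW hdW) (realDiagonal_isSymm L dV hdV)
        (gramR_isSymm L (Equiv.prodUnique (Fin N) (Fin 1)) dV hdV dW hdW) a h₂ (realDiagonal_map L dV hdV).symm
        (reindex_kronecker_eq_gram_map (Fp L) L (Equiv.prodUnique (Fin N) (Fin 1)) (realDiagonal_map L dV hdV).symm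
          (realDiagonal_map L dW hdW).symm) v (𝓢.s v) (𝓢.proj_s v) := by
  subst hT hJ
  rfl

/-! ## §2 The line-rigidity identity S6a -/

-- heartbeats: the statement alone (two transported CM packages spelled in full) exceeds the default budget, as in the
-- consumers `A4LiuD3KudlaNonsplitOfLineRigidity` / `A4LiuD3MuOfIsoNonsplitOfFacts`.
set_option maxHeartbeats 1600000 in
/-- **S6a — NATURALITY OF THE `χ`-ATTACHED LOCAL SPLITTING UNDER THE LOCAL ISOMETRY OF TWO LINES OF THE SAME CLASS.**
For a CM field `L`, a real frame `dV` (rank `N ≥ 1`), a splitting character `χ` (`IsSplittingChar L 1 χ`), lines `a₁, a₂ ∈ L⁺ˣ`,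
a finite place `v` of `L⁺` and a unit `x` of `L ⊗ L⁺_v` with `a₂⁻¹δ = x xᶜ a₁⁻¹δ`: the line transport by `x` of the model-transported
`χ`-attached local splitting on the line `a₁` equals the model-transported `χ`-attached local splitting on the line `a₂` — at
EVERY finite place, GIVEN (`hΔ`) that the doubled line isometry `γ_x ∈ Sp(𝕎^𝔻_v)` preserves `ℓ_Δ` and (`hD4`) that undoubling
commutes with the conjugation by its lift (both: `LocalLineIsometryUndoubling`).
[cite: Kudla1994, §3 Thm 3.1] [cite: GelbartRogawski1991, §3.1 Remark p. 457 L4–13] [cite: MoeglinVignerasWaldspurger1987, Chap. 3 I.1–I.3]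
[cite: Liu2021, App. D Lemma D.1 (3) (l. 5233), proof l. 5249–5255] -/
theorem lineTransportSplitting_lineTransportSection_congrW_undoubledSplittings (hN : 0 < N)
    (χ : HeckeCharacter L) (hχ : IsSplittingChar L 1 χ) (a₁ a₂ : (Fp L)ˣ) (x : (LocalRing L v)ˣ)
    (hx : algebraMap L (LocalRing L v) (algebraMap (Fp L) L (↑a₂⁻¹ : Fp L) * imagUnit L) =
      (x : LocalRing L v) * conjLocal L (IsCMField.complexConj L) v x *
        algebraMap L (LocalRing L v) (algebraMap (Fp L) L (↑a₁⁻¹ : Fp L) * imagUnit L))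
    (hΔ : (deltaLagrangian (Fp L) v N).map (toLin (Fp L) v
        (LineTransport.transportSp L v (IsCMField.complexConj L) (N + N)
          (conj_lineDelta (complexConj_imagUnit L) a₁) (lineDelta_ne_zero (imagUnit_ne_zero L) a₁)
          (lineDelta_mul_self (imagUnit_mul_self L) a₁) (conj_lineDelta (complexConj_imagUnit L) a₂)
          (lineDelta_ne_zero (imagUnit_ne_zero L) a₂) (lineDelta_mul_self (imagUnit_mul_self L) a₂) x
          (gramD (Fp L) N (realDiagonal L dV hdV)) (gramD_isSymm (Fp L) N (realDiagonal_isSymm L dV hdV)) hx)) =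
      deltaLagrangian (Fp L) v N)
    (hD4 : ∀ (S : UnitaryGroup.localPi L (IsCMField.complexConj L) (N + N)
          ((gramD (Fp L) N (realDiagonal L dV hdV)).map (algebraMap (Fp L) L)) v →*
          LocalMp (Fp L) (N + N) (gramD (Fp L) N (realDiagonal L dV hdV)) v)
        (hS : ∀ h, MpPsi.proj _ (S h) = iota (Fp L) L (IsCMField.complexConj L) (N + N)
          (conj_lineDelta (complexConj_imagUnit L) a₁) (lineDelta_ne_zero (imagUnit_ne_zero L) a₁)
          (lineDelta_mul_self (imagUnit_mul_self L) a₁) (gramD (Fp L) N (realDiagonal L dV hdV))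
          (gramD_isSymm (Fp L) N (realDiagonal_isSymm L dV hdV)) rfl v h)
        (P : LocalMp (Fp L) (N + N) (gramD (Fp L) N (realDiagonal L dV hdV)) v)
        (hP : MpPsi.proj _ P = LineTransport.transportSp L v (IsCMField.complexConj L) (N + N)
          (conj_lineDelta (complexConj_imagUnit L) a₁) (lineDelta_ne_zero (imagUnit_ne_zero L) a₁)
          (lineDelta_mul_self (imagUnit_mul_self L) a₁) (conj_lineDelta (complexConj_imagUnit L) a₂)
          (lineDelta_ne_zero (imagUnit_ne_zero L) a₂) (lineDelta_mul_self (imagUnit_mul_self L) a₂) x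
          (gramD (Fp L) N (realDiagonal L dV hdV)) (gramD_isSymm (Fp L) N (realDiagonal_isSymm L dV hdV)) hx)
        (hS' : ∀ h, MpPsi.proj _ (((MulAut.conj P).toMonoidHom.comp S) h) = iota (Fp L) L (IsCMField.complexConj L) (N + N)
          (conj_lineDelta (complexConj_imagUnit L) a₂) (lineDelta_ne_zero (imagUnit_ne_zero L) a₂)
          (lineDelta_mul_self (imagUnit_mul_self L) a₂) (gramD (Fp L) N (realDiagonal L dV hdV))
          (gramD_isSymm (Fp L) N (realDiagonal_isSymm L dV hdV)) rfl v h),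
        undoubleLoc (Fp L) L (IsCMField.complexConj L) v N (realDiagonal_map L dV hdV).symm rfl
            (conj_lineDelta (complexConj_imagUnit L) a₂) (lineDelta_ne_zero (imagUnit_ne_zero L) a₂)
            (lineDelta_mul_self (imagUnit_mul_self L) a₂) (realDiagonal_isSymm L dV hdV) (isUnit_det_realDiagonal L dV hdV hdV0)
            ((MulAut.conj P).toMonoidHom.comp S) hS' =
          lineTransportSplitting L v (IsCMField.complexConj L) N (conj_lineDelta (complexConj_imagUnit L) a₁)
            (lineDelta_ne_zero (imagUnit_ne_zero L) a₁) (lineDelta_mul_self (imagUnit_mul_self L) a₁)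
            (conj_lineDelta (complexConj_imagUnit L) a₂) (lineDelta_ne_zero (imagUnit_ne_zero L) a₂)
            (lineDelta_mul_self (imagUnit_mul_self L) a₂) x (realDiagonal L dV hdV) (realDiagonal_isSymm L dV hdV)
            (isUnit_det_realDiagonal L dV hdV hdV0) hx
            (undoubleLoc (Fp L) L (IsCMField.complexConj L) v N (realDiagonal_map L dV hdV).symm rfl
              (conj_lineDelta (complexConj_imagUnit L) a₁) (lineDelta_ne_zero (imagUnit_ne_zero L) a₁)
              (lineDelta_mul_self (imagUnit_mul_self L) a₁) (realDiagonal_isSymm L dV hdV) (isUnit_det_realDiagonal L dV hdV hdV0)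
              S hS)) :
    lineTransportSplitting L v (IsCMField.complexConj L) N (conj_lineDelta (complexConj_imagUnit L) a₁)
        (lineDelta_ne_zero (imagUnit_ne_zero L) a₁) (lineDelta_mul_self (imagUnit_mul_self L) a₁)
        (conj_lineDelta (complexConj_imagUnit L) a₂) (lineDelta_ne_zero (imagUnit_ne_zero L) a₂)
        (lineDelta_mul_self (imagUnit_mul_self L) a₂) x (realDiagonal L dV hdV) (realDiagonal_isSymm L dV hdV)
        (isUnit_det_realDiagonal L dV hdV hdV0) hx
        (lineTransportSection (Fp L) L (IsCMField.complexConj L) N (complexConj_imagUnit L) (imagUnit_ne_zero L)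
          (imagUnit_mul_self L) (realDiagonal L dV hdV) (realDiagonal_isSymm L dV hdV) (Matrix.diagonal dV)
          (realDiagonal_map L dV hdV).symm a₁ v
          ((congrW L (Equiv.prodUnique (Fin N) (Fin 1)) dV hdV (lineW L (TW (Fp L) a₁)) (complexConj_lineW L (TW (Fp L) a₁))
            (realDiagonal_lineW L (TW (Fp L) a₁)) (diagonal_lineW L (TW (Fp L) a₁) (JW_eq (Fp L) L a₁))
            (undoubledSplittings L (Equiv.prodUnique (Fin N) (Fin 1)) dV hdV hdV0 (lineW L (TW (Fp L) a₁))
              (complexConj_lineW L (TW (Fp L) a₁)) (lineW_ne_zero L (TW (Fp L) a₁) (isUnit_det_TW (Fp L) a₁)) χ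
              (borelPlaceMeasure L)
              (cmFinLocalFamily L (Equiv.prodUnique (Fin N) (Fin 1)) dV hdV hdV0 (lineW L (TW (Fp L) a₁))
                (complexConj_lineW L (TW (Fp L) a₁)) (lineW_ne_zero L (TW (Fp L) a₁) (isUnit_det_TW (Fp L) a₁)) χ hχ
                (borelPlaceMeasure L)))
            (isSymm_TW (Fp L) a₁) (JW_eq (Fp L) L a₁)).s v)
          ((congrW L (Equiv.prodUnique (Fin N) (Fin 1)) dV hdV (lineW L (TW (Fp L) a₁)) (complexConj_lineW L (TW (Fp L) a₁))
            (realDiagonal_lineW L (TW (Fp L) a₁)) (diagonal_lineW L (TW (Fp L) a₁) (JW_eq (Fp L) L a₁))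
            (undoubledSplittings L (Equiv.prodUnique (Fin N) (Fin 1)) dV hdV hdV0 (lineW L (TW (Fp L) a₁))
              (complexConj_lineW L (TW (Fp L) a₁)) (lineW_ne_zero L (TW (Fp L) a₁) (isUnit_det_TW (Fp L) a₁)) χ
              (borelPlaceMeasure L)
              (cmFinLocalFamily L (Equiv.prodUnique (Fin N) (Fin 1)) dV hdV hdV0 (lineW L (TW (Fp L) a₁))
                (complexConj_lineW L (TW (Fp L) a₁)) (lineW_ne_zero L (TW (Fp L) a₁) (isUnit_det_TW (Fp L) a₁)) χ hχ
                (borelPlaceMeasure L)))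
            (isSymm_TW (Fp L) a₁) (JW_eq (Fp L) L a₁)).proj_s v)) =
      lineTransportSection (Fp L) L (IsCMField.complexConj L) N (complexConj_imagUnit L) (imagUnit_ne_zero L)
        (imagUnit_mul_self L) (realDiagonal L dV hdV) (realDiagonal_isSymm L dV hdV) (Matrix.diagonal dV)
        (realDiagonal_map L dV hdV).symm a₂ v
        ((congrW L (Equiv.prodUnique (Fin N) (Fin 1)) dV hdV (lineW L (TW (Fp L) a₂)) (complexConj_lineW L (TW (Fp L) a₂))
          (realDiagonal_lineW L (TW (Fp L) a₂)) (diagonal_lineW L (TW (Fp L) a₂) (JW_eq (Fp L) L a₂))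
          (undoubledSplittings L (Equiv.prodUnique (Fin N) (Fin 1)) dV hdV hdV0 (lineW L (TW (Fp L) a₂))
            (complexConj_lineW L (TW (Fp L) a₂)) (lineW_ne_zero L (TW (Fp L) a₂) (isUnit_det_TW (Fp L) a₂)) χ
            (borelPlaceMeasure L)
            (cmFinLocalFamily L (Equiv.prodUnique (Fin N) (Fin 1)) dV hdV hdV0 (lineW L (TW (Fp L) a₂))
              (complexConj_lineW L (TW (Fp L) a₂)) (lineW_ne_zero L (TW (Fp L) a₂) (isUnit_det_TW (Fp L) a₂)) χ hχ
              (borelPlaceMeasure L)))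
          (isSymm_TW (Fp L) a₂) (JW_eq (Fp L) L a₂)).s v)
        ((congrW L (Equiv.prodUnique (Fin N) (Fin 1)) dV hdV (lineW L (TW (Fp L) a₂)) (complexConj_lineW L (TW (Fp L) a₂))
          (realDiagonal_lineW L (TW (Fp L) a₂)) (diagonal_lineW L (TW (Fp L) a₂) (JW_eq (Fp L) L a₂))
          (undoubledSplittings L (Equiv.prodUnique (Fin N) (Fin 1)) dV hdV hdV0 (lineW L (TW (Fp L) a₂))
            (complexConj_lineW L (TW (Fp L) a₂)) (lineW_ne_zero L (TW (Fp L) a₂) (isUnit_det_TW (Fp L) a₂)) χ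
            (borelPlaceMeasure L)
            (cmFinLocalFamily L (Equiv.prodUnique (Fin N) (Fin 1)) dV hdV hdV0 (lineW L (TW (Fp L) a₂))
              (complexConj_lineW L (TW (Fp L) a₂)) (lineW_ne_zero L (TW (Fp L) a₂) (isUnit_det_TW (Fp L) a₂)) χ hχ
              (borelPlaceMeasure L)))
          (isSymm_TW (Fp L) a₂) (JW_eq (Fp L) L a₂)).proj_s v) := by
  letI : MeasurableSpace (v.adicCompletion (Fp L)) := borel _
  haveI : BorelSpace (v.adicCompletion (Fp L)) := ⟨rfl⟩
  -- the Gram data of the line `a`: `gramR e₁ dV (lineW (a)) = a • T_V`, `gramD N (…) = a • gramD N T_V`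
  have hTT₀ : ∀ a : (Fp L)ˣ, gramR L (Equiv.prodUnique (Fin N) (Fin 1)) dV hdV (lineW L (TW (Fp L) a))
      (complexConj_lineW L (TW (Fp L) a)) = (a : Fp L) • realDiagonal L dV hdV := fun a => by
    change gram (Fp L) (Equiv.prodUnique (Fin N) (Fin 1)) (realDiagonal L dV hdV)
        (realDiagonal L (lineW L (TW (Fp L) a)) (complexConj_lineW L (TW (Fp L) a))) = _
    rw [realDiagonal_lineW, gram_prodUnique_TW]
  have hT₁ : ∀ a : (Fp L)ˣ, gram (Fp L) (Equiv.prodUnique (Fin N) (Fin 1)) (realDiagonal L dV hdV) (TW (Fp L) a) =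
      (a : Fp L) • realDiagonal L dV hdV := fun a => gram_prodUnique_TW (Fp L) N a (realDiagonal L dV hdV)
  have hDD : ∀ a : (Fp L)ˣ, gramD (Fp L) N (gramR L (Equiv.prodUnique (Fin N) (Fin 1)) dV hdV (lineW L (TW (Fp L) a))
      (complexConj_lineW L (TW (Fp L) a))) = (a : Fp L) • gramD (Fp L) N (realDiagonal L dV hdV) := fun a =>
    gramD_of_eq_smul (Fp L) a (hTT₀ a)
  -- (1) the undoubled section on the line `a`, transported, IS the undoubling of the scale-transported doubled CM section `Σ_a`
  have hS : ∀ a : (Fp L)ˣ,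
      lineTransportSection (Fp L) L (IsCMField.complexConj L) N (complexConj_imagUnit L) (imagUnit_ne_zero L)
          (imagUnit_mul_self L) (realDiagonal L dV hdV) (realDiagonal_isSymm L dV hdV) (Matrix.diagonal dV)
          (realDiagonal_map L dV hdV).symm a v
          ((congrW L (Equiv.prodUnique (Fin N) (Fin 1)) dV hdV (lineW L (TW (Fp L) a)) (complexConj_lineW L (TW (Fp L) a))
            (realDiagonal_lineW L (TW (Fp L) a)) (diagonal_lineW L (TW (Fp L) a) (JW_eq (Fp L) L a))
            (undoubledSplittings L (Equiv.prodUnique (Fin N) (Fin 1)) dV hdV hdV0 (lineW L (TW (Fp L) a))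
              (complexConj_lineW L (TW (Fp L) a)) (lineW_ne_zero L (TW (Fp L) a) (isUnit_det_TW (Fp L) a)) χ
              (borelPlaceMeasure L)
              (cmFinLocalFamily L (Equiv.prodUnique (Fin N) (Fin 1)) dV hdV hdV0 (lineW L (TW (Fp L) a))
                (complexConj_lineW L (TW (Fp L) a)) (lineW_ne_zero L (TW (Fp L) a) (isUnit_det_TW (Fp L) a)) χ hχ
                (borelPlaceMeasure L)))
            (isSymm_TW (Fp L) a) (JW_eq (Fp L) L a)).s v)
          ((congrW L (Equiv.prodUnique (Fin N) (Fin 1)) dV hdV (lineW L (TW (Fp L) a)) (complexConj_lineW L (TW (Fp L) a))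
            (realDiagonal_lineW L (TW (Fp L) a)) (diagonal_lineW L (TW (Fp L) a) (JW_eq (Fp L) L a))
            (undoubledSplittings L (Equiv.prodUnique (Fin N) (Fin 1)) dV hdV hdV0 (lineW L (TW (Fp L) a))
              (complexConj_lineW L (TW (Fp L) a)) (lineW_ne_zero L (TW (Fp L) a) (isUnit_det_TW (Fp L) a)) χ
              (borelPlaceMeasure L)
              (cmFinLocalFamily L (Equiv.prodUnique (Fin N) (Fin 1)) dV hdV hdV0 (lineW L (TW (Fp L) a))
                (complexConj_lineW L (TW (Fp L) a)) (lineW_ne_zero L (TW (Fp L) a) (isUnit_det_TW (Fp L) a)) χ hχ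
                (borelPlaceMeasure L)))
            (isSymm_TW (Fp L) a) (JW_eq (Fp L) L a)).proj_s v) =
        undoubleLoc (Fp L) L (IsCMField.complexConj L) v N (realDiagonal_map L dV hdV).symm rfl
          (conj_lineDelta (complexConj_imagUnit L) a) (lineDelta_ne_zero (imagUnit_ne_zero L) a)
          (lineDelta_mul_self (imagUnit_mul_self L) a) (realDiagonal_isSymm L dV hdV) (isUnit_det_realDiagonal L dV hdV hdV0)
          (scaleTransportSection (Fp L) L (IsCMField.complexConj L) (N + N) (complexConj_imagUnit L) (imagUnit_ne_zero L)
            (imagUnit_mul_self L) (gramD (Fp L) N (realDiagonal L dV hdV))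
            (gramD (Fp L) N (gramR L (Equiv.prodUnique (Fin N) (Fin 1)) dV hdV (lineW L (TW (Fp L) a))
              (complexConj_lineW L (TW (Fp L) a))))
            (gramD_isSymm (Fp L) N (realDiagonal_isSymm L dV hdV))
            (gramD_isSymm (Fp L) N (gramR_isSymm L (Equiv.prodUnique (Fin N) (Fin 1)) dV hdV (lineW L (TW (Fp L) a))
              (complexConj_lineW L (TW (Fp L) a)))) a (hDD a) rfl rfl v
            (localSplittingDatumCM L v MeasureTheory.Measure.addHaar N
              (gramR_isSymm L (Equiv.prodUnique (Fin N) (Fin 1)) dV hdV (lineW L (TW (Fp L) a)) (complexConj_lineW L (TW (Fp L) a)))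
              (isUnit_det_gramR₀ L (Equiv.prodUnique (Fin N) (Fin 1)) dV hdV hdV0 (lineW L (TW (Fp L) a))
                (complexConj_lineW L (TW (Fp L) a)) (lineW_ne_zero L (TW (Fp L) a) (isUnit_det_TW (Fp L) a))) rfl χ hχ).localSplitting
            (localSplittingDatumCM L v MeasureTheory.Measure.addHaar N
              (gramR_isSymm L (Equiv.prodUnique (Fin N) (Fin 1)) dV hdV (lineW L (TW (Fp L) a)) (complexConj_lineW L (TW (Fp L) a)))
              (isUnit_det_gramR₀ L (Equiv.prodUnique (Fin N) (Fin 1)) dV hdV hdV0 (lineW L (TW (Fp L) a))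
                (complexConj_lineW L (TW (Fp L) a)) (lineW_ne_zero L (TW (Fp L) a) (isUnit_det_TW (Fp L) a))) rfl χ hχ).proj_localSplitting)
          (proj_scaleTransportSection (Fp L) L (IsCMField.complexConj L) (N + N) (complexConj_imagUnit L) (imagUnit_ne_zero L)
            (imagUnit_mul_self L) (gramD (Fp L) N (realDiagonal L dV hdV))
            (gramD (Fp L) N (gramR L (Equiv.prodUnique (Fin N) (Fin 1)) dV hdV (lineW L (TW (Fp L) a))
              (complexConj_lineW L (TW (Fp L) a))))
            (gramD_isSymm (Fp L) N (realDiagonal_isSymm L dV hdV))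
            (gramD_isSymm (Fp L) N (gramR_isSymm L (Equiv.prodUnique (Fin N) (Fin 1)) dV hdV (lineW L (TW (Fp L) a))
              (complexConj_lineW L (TW (Fp L) a)))) a (hDD a) rfl rfl v _ _) := by
    intro a
    rw [lineTransportSection_eq_scaleTransportSection, scaleTransportSection_congrW_s L dV hdV v (lineW L (TW (Fp L) a))
      (complexConj_lineW L (TW (Fp L) a)) (realDiagonal_lineW L (TW (Fp L) a)) (diagonal_lineW L (TW (Fp L) a) (JW_eq (Fp L) L a))
      (isSymm_TW (Fp L) a) (JW_eq (Fp L) L a) _ a (hT₁ a) (hTT₀ a)]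
    have h3 := scaleTransportSection_localSplittingCMWith L v MeasureTheory.Measure.addHaar N a (realDiagonal_isSymm L dV hdV)
      (gramR_isSymm L (Equiv.prodUnique (Fin N) (Fin 1)) dV hdV (lineW L (TW (Fp L) a)) (complexConj_lineW L (TW (Fp L) a)))
      (isUnit_det_realDiagonal L dV hdV hdV0)
      (isUnit_det_gramR₀ L (Equiv.prodUnique (Fin N) (Fin 1)) dV hdV hdV0 (lineW L (TW (Fp L) a)) (complexConj_lineW L (TW (Fp L) a))
        (lineW_ne_zero L (TW (Fp L) a) (isUnit_det_TW (Fp L) a)))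
      (hTT₀ a) (hDD a) (realDiagonal_map L dV hdV).symm
      (reindex_kronecker_eq_gram_map (Fp L) L (Equiv.prodUnique (Fin N) (Fin 1)) (realDiagonal_map L dV hdV).symm
        (realDiagonal_map L (lineW L (TW (Fp L) a)) (complexConj_lineW L (TW (Fp L) a))).symm) χ hχ
    -- the undoubled family member IS `localSplittingCMWith … Measure.addHaar` (`undouble_finSplittings_cmFinLocalFamily_s`)
    rw [← h3]
    have h2 : (undoubledSplittings L (Equiv.prodUnique (Fin N) (Fin 1)) dV hdV hdV0 (lineW L (TW (Fp L) a))
          (complexConj_lineW L (TW (Fp L) a)) (lineW_ne_zero L (TW (Fp L) a) (isUnit_det_TW (Fp L) a)) χ (borelPlaceMeasure L)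
          (cmFinLocalFamily L (Equiv.prodUnique (Fin N) (Fin 1)) dV hdV hdV0 (lineW L (TW (Fp L) a))
            (complexConj_lineW L (TW (Fp L) a)) (lineW_ne_zero L (TW (Fp L) a) (isUnit_det_TW (Fp L) a)) χ hχ (borelPlaceMeasure L))).s v =
        localSplittingCMWith L N
          (gramR_isSymm L (Equiv.prodUnique (Fin N) (Fin 1)) dV hdV (lineW L (TW (Fp L) a)) (complexConj_lineW L (TW (Fp L) a)))
          (isUnit_det_gramR₀ L (Equiv.prodUnique (Fin N) (Fin 1)) dV hdV hdV0 (lineW L (TW (Fp L) a)) (complexConj_lineW L (TW (Fp L) a))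
            (lineW_ne_zero L (TW (Fp L) a) (isUnit_det_TW (Fp L) a)))
          (reindex_kronecker_eq_gram_map (Fp L) L (Equiv.prodUnique (Fin N) (Fin 1)) (realDiagonal_map L dV hdV).symm
            (realDiagonal_map L (lineW L (TW (Fp L) a)) (complexConj_lineW L (TW (Fp L) a))).symm) χ hχ v MeasureTheory.Measure.addHaar :=
      undouble_finSplittings_cmFinLocalFamily_s L (Equiv.prodUnique (Fin N) (Fin 1)) dV hdV hdV0 (lineW L (TW (Fp L) a))
        (complexConj_lineW L (TW (Fp L) a)) (lineW_ne_zero L (TW (Fp L) a) (isUnit_det_TW (Fp L) a)) χ hχ _ v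
    exact scaleTransportSection_congr_s (Fp L) L (IsCMField.complexConj L) N (complexConj_imagUnit L) (imagUnit_ne_zero L)
      (imagUnit_mul_self L) _ _ _ _ a _ _ _ v h2 _ _
  -- (2) a lift `P` of the doubled line isometry `γ_x`, preserving `ℓ_Δ`
  obtain ⟨P, hPproj⟩ : ∃ P : LocalMp (Fp L) (N + N) (gramD (Fp L) N (realDiagonal L dV hdV)) v,
      MpPsi.proj _ P = LineTransport.transportSp L v (IsCMField.complexConj L) (N + N)
        (conj_lineDelta (complexConj_imagUnit L) a₁) (lineDelta_ne_zero (imagUnit_ne_zero L) a₁)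
        (lineDelta_mul_self (imagUnit_mul_self L) a₁) (conj_lineDelta (complexConj_imagUnit L) a₂)
        (lineDelta_ne_zero (imagUnit_ne_zero L) a₂) (lineDelta_mul_self (imagUnit_mul_self L) a₂) x
        (gramD (Fp L) N (realDiagonal L dV hdV)) (gramD_isSymm (Fp L) N (realDiagonal_isSymm L dV hdV)) hx :=
    ⟨_, proj_lineTransportLift L v (IsCMField.complexConj L) (N + N) (conj_lineDelta (complexConj_imagUnit L) a₁)
      (lineDelta_ne_zero (imagUnit_ne_zero L) a₁) (lineDelta_mul_self (imagUnit_mul_self L) a₁)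
      (conj_lineDelta (complexConj_imagUnit L) a₂) (lineDelta_ne_zero (imagUnit_ne_zero L) a₂)
      (lineDelta_mul_self (imagUnit_mul_self L) a₂) x (gramD (Fp L) N (realDiagonal L dV hdV))
      (gramD_isSymm (Fp L) N (realDiagonal_isSymm L dV hdV))
      (isUnit_det_gramD (Fp L) N (isUnit_det_realDiagonal L dV hdV hdV0)) hx⟩
  have hP : (deltaLagrangian (Fp L) v N).map (toLin (Fp L) v (MpPsi.proj _ P)) = deltaLagrangian (Fp L) v N := by
    rw [hPproj]; exact hΔ
  -- (3) a mover of `ℓ_Δ` onto `ℓ_Y` (the rational `δ` of the doubled space, `deltaD`, lifted)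
  have hTv : IsUnit (localGram (Fp L) (N + N) (gramD (Fp L) N (realDiagonal L dV hdV)) v).det :=
    UnitaryGroup.isUnit_det_map (algebraMap (Fp L) (v.adicCompletion (Fp L)))
      (isUnit_det_gramD (Fp L) N (isUnit_det_realDiagonal L dV hdV hdV0))
  have hδ₀ := map_transportSp_deltaDiag_deltaLagrangian (Fp L) v N (T₀ := realDiagonal L dV hdV)
    (isUnit_det_realDiagonal L dV hdV hdV0) hTv (SymplecticMatrix.mapHom (algebraMap (Fp L) (v.adicCompletion (Fp L))) (deltaD L))
    (by
      rw [SymplecticMatrix.coe_mapHom]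
      change (Matrix.reindex _ _ (deltaDiagMatrix (Fp L) (Fin N))).map _ = _
      rw [Matrix.reindex_apply, Matrix.reindex_apply, ← Matrix.submatrix_map, deltaDiagMatrix_map])
  obtain ⟨m₀, hm₀'⟩ := MpPsi.proj_surjective _ (existsImplementer_localSchrodinger (Fp L) (N + N)
    (gramD (Fp L) N (realDiagonal L dV hdV)) (isUnit_det_gramD (Fp L) N (isUnit_det_realDiagonal L dV hdV hdV0)) v)
    (transportSp (localGram (Fp L) (N + N) (gramD (Fp L) N (realDiagonal L dV hdV)) v) hTv
      (SymplecticMatrix.mapHom (algebraMap (Fp L) (v.adicCompletion (Fp L))) (deltaD L)))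
  have hm₀ : (deltaLagrangian (Fp L) v N).map (toLin (Fp L) v (MpPsi.proj _ m₀)) = lagrangianY (Fp L) (N + N) v := by
    rw [hm₀']; exact hδ₀
  -- (4) every character of `H(L⁺_v)` trivial on `P_Δ` is trivial (all places; `T_V = diagonal`)
  have hκ : ∀ θ : UnitaryGroup.localPi L (IsCMField.complexConj L) (N + N)
      ((gramD (Fp L) N (realDiagonal L dV hdV)).map (algebraMap (Fp L) L)) v →* ℂˣ,
      (∀ p, IsSiegelDelta (Fp L) L (IsCMField.complexConj L) (conj_lineDelta (complexConj_imagUnit L) a₂)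
        (lineDelta_ne_zero (imagUnit_ne_zero L) a₂) (lineDelta_mul_self (imagUnit_mul_self L) a₂) v N
        (realDiagonal_isSymm L dV hdV) rfl p → θ p = 1) → θ = 1 := fun θ hθ =>
    eq_one_of_forall_isSiegelDelta_eq_one' (Fp L) L (IsCMField.complexConj L) (conj_lineDelta (complexConj_imagUnit L) a₂)
      (lineDelta_ne_zero (imagUnit_ne_zero L) a₂) (lineDelta_mul_self (imagUnit_mul_self L) a₂) v N hN
      (fun i => (⟨dV i, (IsCMField.complexConj_eq_self_iff (K := L) (dV i)).1 (hdV i)⟩ : Fp L)) rfl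
      (realDiagonal_isSymm L dV hdV) (isUnit_det_realDiagonal L dV hdV hdV0) rfl θ hθ
  -- (5) rigidity at the doubled level: `P Σ_{a₁} P⁻¹ = Σ_{a₂}`
  have hconj := conj_comp_eq_of_parabolic (Fp L) L (IsCMField.complexConj L) v N
    (conj_lineDelta (complexConj_imagUnit L) a₁) (lineDelta_ne_zero (imagUnit_ne_zero L) a₁) (lineDelta_mul_self (imagUnit_mul_self L) a₁)
    (conj_lineDelta (complexConj_imagUnit L) a₂) (lineDelta_ne_zero (imagUnit_ne_zero L) a₂) (lineDelta_mul_self (imagUnit_mul_self L) a₂)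
    (realDiagonal_isSymm L dV hdV) (isUnit_det_realDiagonal L dV hdV hdV0) rfl x hx _ _
    (proj_scaleTransportSection (Fp L) L (IsCMField.complexConj L) (N + N) (complexConj_imagUnit L) (imagUnit_ne_zero L)
      (imagUnit_mul_self L) (gramD (Fp L) N (realDiagonal L dV hdV))
      (gramD (Fp L) N (gramR L (Equiv.prodUnique (Fin N) (Fin 1)) dV hdV (lineW L (TW (Fp L) a₁)) (complexConj_lineW L (TW (Fp L) a₁))))
      (gramD_isSymm (Fp L) N (realDiagonal_isSymm L dV hdV))
      (gramD_isSymm (Fp L) N (gramR_isSymm L (Equiv.prodUnique (Fin N) (Fin 1)) dV hdV (lineW L (TW (Fp L) a₁))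
        (complexConj_lineW L (TW (Fp L) a₁)))) a₁ (hDD a₁) rfl rfl v _ _)
    (proj_scaleTransportSection (Fp L) L (IsCMField.complexConj L) (N + N) (complexConj_imagUnit L) (imagUnit_ne_zero L)
      (imagUnit_mul_self L) (gramD (Fp L) N (realDiagonal L dV hdV))
      (gramD (Fp L) N (gramR L (Equiv.prodUnique (Fin N) (Fin 1)) dV hdV (lineW L (TW (Fp L) a₂)) (complexConj_lineW L (TW (Fp L) a₂))))
      (gramD_isSymm (Fp L) N (realDiagonal_isSymm L dV hdV))
      (gramD_isSymm (Fp L) N (gramR_isSymm L (Equiv.prodUnique (Fin N) (Fin 1)) dV hdV (lineW L (TW (Fp L) a₂))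
        (complexConj_lineW L (TW (Fp L) a₂)))) a₂ (hDD a₂) rfl rfl v _ _)
    (fun p => (((chiDet (Fp L) L (IsCMField.complexConj L) v N (fun w' : PlacesOver L v => (χ.localComponent w'.1)⁻¹) p)⁻¹ : ℂˣ) : ℂ) *
      ((∏ w' : PlacesOver L v, Real.sqrt ‖detDelta (Fp L) L (IsCMField.complexConj L) v N w' p‖ : ℝ) : ℂ))
    (fun p hp => parabolicScalar_ne_zero (Fp L) L (IsCMField.complexConj L) (conj_lineDelta (complexConj_imagUnit L) a₂)
      (lineDelta_ne_zero (imagUnit_ne_zero L) a₂) (lineDelta_mul_self (imagUnit_mul_self L) a₂) v N (realDiagonal_isSymm L dV hdV) rfl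
      (fun w' : PlacesOver L v => (χ.localComponent w'.1)⁻¹) hp)
    (fun m hm p hp Φ => parabolic_toRep_conj_scaleTransport_localSplittingDatumCM L v MeasureTheory.Measure.addHaar N a₁
      (realDiagonal_isSymm L dV hdV)
      (gramR_isSymm L (Equiv.prodUnique (Fin N) (Fin 1)) dV hdV (lineW L (TW (Fp L) a₁)) (complexConj_lineW L (TW (Fp L) a₁)))
      (isUnit_det_gramR₀ L (Equiv.prodUnique (Fin N) (Fin 1)) dV hdV hdV0 (lineW L (TW (Fp L) a₁)) (complexConj_lineW L (TW (Fp L) a₁))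
        (lineW_ne_zero L (TW (Fp L) a₁) (isUnit_det_TW (Fp L) a₁))) (hDD a₁) χ hχ m hm p hp Φ)
    (fun m hm p hp Φ => parabolic_toRep_conj_scaleTransport_localSplittingDatumCM L v MeasureTheory.Measure.addHaar N a₂
      (realDiagonal_isSymm L dV hdV)
      (gramR_isSymm L (Equiv.prodUnique (Fin N) (Fin 1)) dV hdV (lineW L (TW (Fp L) a₂)) (complexConj_lineW L (TW (Fp L) a₂)))
      (isUnit_det_gramR₀ L (Equiv.prodUnique (Fin N) (Fin 1)) dV hdV hdV0 (lineW L (TW (Fp L) a₂)) (complexConj_lineW L (TW (Fp L) a₂))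
        (lineW_ne_zero L (TW (Fp L) a₂) (isUnit_det_TW (Fp L) a₂))) (hDD a₂) χ hχ m hm p hp Φ)
    hκ P hPproj hP m₀ hm₀
  -- (6) undouble: undoubling commutes with the conjugation (`hD4`), and the transported sections are the undoublings (1)
  have hproj' := proj_conj_comp_eq_iota (Fp L) L (IsCMField.complexConj L) v N
    (conj_lineDelta (complexConj_imagUnit L) a₁) (lineDelta_ne_zero (imagUnit_ne_zero L) a₁) (lineDelta_mul_self (imagUnit_mul_self L) a₁)
    (conj_lineDelta (complexConj_imagUnit L) a₂) (lineDelta_ne_zero (imagUnit_ne_zero L) a₂) (lineDelta_mul_self (imagUnit_mul_self L) a₂)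
    (realDiagonal_isSymm L dV hdV) rfl x hx _
    (proj_scaleTransportSection (Fp L) L (IsCMField.complexConj L) (N + N) (complexConj_imagUnit L) (imagUnit_ne_zero L)
      (imagUnit_mul_self L) (gramD (Fp L) N (realDiagonal L dV hdV))
      (gramD (Fp L) N (gramR L (Equiv.prodUnique (Fin N) (Fin 1)) dV hdV (lineW L (TW (Fp L) a₁)) (complexConj_lineW L (TW (Fp L) a₁))))
      (gramD_isSymm (Fp L) N (realDiagonal_isSymm L dV hdV))
      (gramD_isSymm (Fp L) N (gramR_isSymm L (Equiv.prodUnique (Fin N) (Fin 1)) dV hdV (lineW L (TW (Fp L) a₁))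
        (complexConj_lineW L (TW (Fp L) a₁)))) a₁ (hDD a₁) rfl rfl v
      (localSplittingDatumCM L v MeasureTheory.Measure.addHaar N
        (gramR_isSymm L (Equiv.prodUnique (Fin N) (Fin 1)) dV hdV (lineW L (TW (Fp L) a₁)) (complexConj_lineW L (TW (Fp L) a₁)))
        (isUnit_det_gramR₀ L (Equiv.prodUnique (Fin N) (Fin 1)) dV hdV hdV0 (lineW L (TW (Fp L) a₁))
          (complexConj_lineW L (TW (Fp L) a₁)) (lineW_ne_zero L (TW (Fp L) a₁) (isUnit_det_TW (Fp L) a₁))) rfl χ hχ).localSplitting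
      (localSplittingDatumCM L v MeasureTheory.Measure.addHaar N
        (gramR_isSymm L (Equiv.prodUnique (Fin N) (Fin 1)) dV hdV (lineW L (TW (Fp L) a₁)) (complexConj_lineW L (TW (Fp L) a₁)))
        (isUnit_det_gramR₀ L (Equiv.prodUnique (Fin N) (Fin 1)) dV hdV hdV0 (lineW L (TW (Fp L) a₁))
          (complexConj_lineW L (TW (Fp L) a₁)) (lineW_ne_zero L (TW (Fp L) a₁) (isUnit_det_TW (Fp L) a₁))) rfl χ hχ).proj_localSplitting)
    P hPproj
  rw [hS a₁, hS a₂, ← hD4 _ _ P hPproj hproj']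
  exact undoubleLoc_congr_s (Fp L) L (IsCMField.complexConj L) v N (realDiagonal_map L dV hdV).symm rfl
    (conj_lineDelta (complexConj_imagUnit L) a₂) (lineDelta_ne_zero (imagUnit_ne_zero L) a₂)
    (lineDelta_mul_self (imagUnit_mul_self L) a₂) (realDiagonal_isSymm L dV hdV) (isUnit_det_realDiagonal L dV hdV hdV0) hconj _ _

end Literature.NumberTheory.GelbartRogawski1991.UnitaryDualPair.LocalSplitting

end
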